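import Literature.MathematicalPhysics.QuantumFieldTheory.Balaban1983to89.B5Symbol166
import Literature.MathematicalPhysics.QuantumFieldTheory.Balaban1983to89.B5Strip145Decay

/-!
# `Balaban1983to89.B5Symbol166Strip` — the (1.66) integrand is a STRIP-REGULAR multiplier (analyticity inputs for the kernel of `Δ_k`)

T. Bałaban, *Propagators and renormalization transformations for lattice gauge theories. I*, Commun. Math.
Phys. **95**, 17–40 (1984) [`Balaban1984PropagatorsI`, cell paper B5], (1.66) p. 29 [PDF 13]; the USE of the
decay of the kernel of `Δ_k`: *… II*, Commun. Math. Phys. **96**, 223–250 (1984) [`Balaban1984PropagatorsII`,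
B6] p. 250 [PDF 28], verbatim (render `…rt-II-p028-x2.png`): «C is a short-ranged operator, so C*Δ_kC has the
same exponential decay as Δ_k. Now we may apply the theory developed in Sect. 5 of [3] on unit lattice
operators.»; the METHOD: B5 p. 38 [PDF 22], the sentence before (1.126), «… the analyticity method of proving an
exponential decay (see the proof of Lemma 2.4 in [2])» ([2] = B4, CMP 89, p. 586).

CITATION HEADER (lean-in-tree rule).  This module is a SUPPLEMENT, not a quotation: neither B5 nor B6 prints a
display asserting the decay of the kernel of the operator `Δ_k` of (1.66); B6 p. 250 presupposes it.  Everything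
below is `[folklore]` audit mathematics about the complex continuation `W166` (module `B5Symbol166`, this unit) of the
typed (1.66) integrand `B5Bounds167Lattice.w166`; `[cite]` tags are text locations only.  ABSOLUTE RULE honoured:
no statement of the papers is used as a hypothesis; imports are kernel-proved tree modules only.

CONTENT (module A2 of the node KERNEL-DECAY-166; A1 = `B5Symbol166`, B = the torus-kernel joiner).  With the
tree's strip engine (`B4Strip`/`B4StripCauchy`: fat region `Fat d r`, `r = rOf d`, Cauchy-estimate Lipschitz lemma
`imLipschitz_of_fat`, perturbation lemma `strip_lower_bound`; `B5Strip145Analytic`: joint holomorphy tools, the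
`2π`-translate `tr`, the residue relabelling `sigma`; `B4ContourShift.StripRegular`):
* §1 uniform bounds on the fat region, `n ≥ 1` arbitrary: `‖cfac‖ ≤ 4^{d+1}`, `‖Rt‖ ≤ 66·132^d`, `‖Yc‖ ≤ 2B²`,
  `‖F66‖ ≤ MF d`, `‖Π Yc‖ ≤ (2B²)^d` (`B = Bc d`, `MF d` explicit, depending on `d` only);
* §2 joint holomorphy of `cfac`, `Rt`, `Yc`, `F66`, `Π Yc` on the fat region, of `W166` where `F66 ≠ 0`;
* §3 **the zero-free strip**: for `0 ≤ κ ≤ kappa166 d` (explicit, `d` only) and every `p ∈ Strip d κ`,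
  `((4/π²)^d)^d / 2 ≤ ‖F66 n p‖` (real lower bound `B5Symbol166.F66r_lower` + imaginary Lipschitz), uniformly in `n`;
* §4 **periodicity across the strip sides**: `W166 n μ ν (tr p i) = W166 n μ ν p` for `p ∈ Strip d κ` with
  `Re p_i = −π` (`μ ≠ ν`), from the quasi-periodicity rules `Yc(tr p)·Δ(p) = Δ(tr p)·Yc(p)`,
  `E66(tr p)·Δ(p)^{d−1} = Δ(tr p)^{d−1}·E66(p)` and `E66 = Δ·F66`;
* §5 **`stripRegular_W166`**: `StripRegular (fun p => W166 n μ ν p) κ (MW (d+1))` on `ℂ^{d+1}` for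
  `0 ≤ κ ≤ kappa166 (d+1)`, `μ ≠ ν`, EVERY `n ≥ 1` — the hypotheses of the contour-shift / torus-kernel engines
  (`B4ContourShift.latticeKernel_decay`, `B4TorusKernel.MultiPeriod.torusKernel_descend_decay_torusMetric`);
* §6 the bounded entire factors `e^{∓ip_a} − 1` (continuations of `conj ∂¹_a(p′)`, `∂¹_b(p′)`) and the matrix-entry
  symbol `Gsym n μ ν a b = ½·W166·(e^{−ip_a} − 1)(e^{ip_b} − 1)`: `stripRegular_Gsym`.

HONEST SCOPE.  (i) No kernel / decay statement is made here (that is module B, on the torus of B6 §2).  (ii) The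
constants `kappa166`, `MW`, `MG` are crude (worst-case products of the fat-region bounds); only their dependence on
`d` alone matters.  (iii) `U = 1` throughout, as in `B5Bounds167Lattice`.  Value = kernel certificate (the analytic
half of the analyticity method for (1.66)), NOT summit progress.  Unit `b2b-balaban-b05-g9` (B05 cell, generation 9).
-/

noncomputable section

open Finset Complex

namespace Literature.MathematicalPhysics.QuantumFieldTheory.Balaban1983to89.B5Symbol166Strip

open Literature.MathematicalPhysics.QuantumFieldTheory.Balaban1983to89.B4Strip
open Literature.MathematicalPhysics.QuantumFieldTheory.Balaban1983to89.B4StripCauchy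
open Literature.MathematicalPhysics.QuantumFieldTheory.Balaban1983to89.B5Prop11Leaves
open Literature.MathematicalPhysics.QuantumFieldTheory.Balaban1983to89.B5Prop11Fiber
open Literature.MathematicalPhysics.QuantumFieldTheory.Balaban1983to89.B5Bounds167Lattice
open Literature.MathematicalPhysics.QuantumFieldTheory.Balaban1983to89.B5Symbol166
open Literature.MathematicalPhysics.QuantumFieldTheory.Balaban1983to89.B5Strip145Analytic
open Literature.MathematicalPhysics.QuantumFieldTheory.Balaban1983to89.B4ContourShift
open Literature.MathematicalPhysics.QuantumFieldTheory.Balaban1983to89.B5Strip145Decay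

variable {d : ℕ}

/-! ### §1 Uniform bounds on the fat region `F_r`, `r ≤ 1/4`, `d r² ≤ 1/16` -/

/-- the universal fat-region constant `B = 16d + 4^{d+1} + 66·132^d + 16` (dominates `‖Δ‖`, `‖cfac‖`, `‖Rt‖`,
`‖S₁‖` there). [folklore] -/
def Bc (d : ℕ) : ℝ := 16 * d + 4 ^ (d + 1) + 66 * 132 ^ d + 16

/-- `1 ≤ B`. [folklore] -/
theorem one_le_Bc (d : ℕ) : 1 ≤ Bc d := by
  unfold Bc
  have h1 : (0 : ℝ) ≤ 16 * d := by positivity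
  have h2 : (0 : ℝ) ≤ 4 ^ (d + 1) := by positivity
  have h3 : (0 : ℝ) ≤ 66 * 132 ^ d := by positivity
  linarith

/-- `0 < B`. [folklore] -/
theorem Bc_pos (d : ℕ) : 0 < Bc d := lt_of_lt_of_le one_pos (one_le_Bc d)

/-- a single residue factor is bounded by the residue sum: `‖u_n(j; z)‖ ≤ 132` on the fat box. [folklore] -/
theorem norm_uFactor_le_132 (n : ℕ) [NeZero n] (j : Fin n) {z : ℂ} {r : ℝ} (hr : r ≤ 1 / 4)
    (hx : |z.re| ≤ Real.pi + r) (hy : |z.im| ≤ 2 * r) : ‖uFactor n (j : ℕ) z‖ ≤ 132 := by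
  have h := sum_norm_uFactor_le n hr hx hy
  have hle : ‖uFactor n (j : ℕ) z‖ ≤ ∑ j' : Fin n, ‖uFactor n (j' : ℕ) z‖ :=
    Finset.single_le_sum (f := fun j' : Fin n => ‖uFactor n (j' : ℕ) z‖) (fun _ _ => norm_nonneg _)
      (Finset.mem_univ j)
  exact hle.trans h

/-- `‖cfac‖ ≤ 4^{d+1}` on `F_r`. [folklore] -/
theorem norm_cfac_le (n : ℕ) [NeZero n] {r : ℝ} (hr : r ≤ 1 / 4) {q : Fin d → ℂ} (hq : q ∈ Fat d r)
    (lam : Fin d) : ‖cfac n lam q‖ ≤ 4 ^ (d + 1) := by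
  have hn : 1 ≤ n := Nat.one_le_iff_ne_zero.mpr (NeZero.ne n)
  unfold cfac
  rw [norm_mul, pow_succ]
  exact mul_le_mul (norm_U_zero_le n hr hq) (norm_uFactor_zero_le n hn hr (hq lam).1 (hq lam).2)
    (norm_nonneg _) (by positivity)

/-- `‖Δ^ξ(q)‖ ≤ 16d` on `F_r` (`m² = 0`). [folklore] -/
theorem norm_DeltaXi0_le (n : ℕ) [NeZero n] {r : ℝ} (hr : r ≤ 1 / 4) {q : Fin d → ℂ} (hq : q ∈ Fat d r) :
    ‖DeltaXi n 0 q‖ ≤ 16 * d := by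
  have hn : 1 ≤ n := Nat.one_le_iff_ne_zero.mpr (NeZero.ne n)
  have := norm_DeltaXi_le n hn 0 le_rfl hr hq
  linarith

/-- `‖Rt‖ ≤ 66·132^d` on `F_r` (shifted denominators `≥ 2`, residue sums `≤ 132`, `Σ_k ‖U_k‖ ≤ 132^d`). [folklore] -/
theorem norm_Rt_le (n : ℕ) [NeZero n] {r : ℝ} (hr : r ≤ 1 / 4) (hdr : (d : ℝ) * r ^ 2 ≤ 1 / 16)
    {q : Fin d → ℂ} (hq : q ∈ Fat d r) (lam : Fin d) : ‖Rt n lam q‖ ≤ 66 * 132 ^ d := by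
  unfold Rt
  have hterm : ∀ k ∈ (univ : Finset (Fin d → Fin n)).erase (fun _ => 0),
      ‖U n k q * uFactor n (k lam : ℕ) (q lam) / DeltaXi n 0 (shift n k q)‖ ≤ 66 * ‖U n k q‖ := by
    intro k hk
    have hk0 : k ≠ fun _ => 0 := Finset.ne_of_mem_erase hk
    have hΔ : 2 ≤ ‖DeltaXi n 0 (shift n k q)‖ := norm_DeltaXi_shift_ge n 0 le_rfl hr hdr hq k hk0
    have hu : ‖uFactor n (k lam : ℕ) (q lam)‖ ≤ 132 := norm_uFactor_le_132 n (k lam) hr (hq lam).1 (hq lam).2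
    rw [norm_div, norm_mul]
    rw [div_le_iff₀ (by linarith)]
    have hU := norm_nonneg (U n k q)
    nlinarith [norm_nonneg (uFactor n (k lam : ℕ) (q lam))]
  calc ‖∑ k ∈ univ.erase (fun _ => (0 : Fin n)), U n k q * uFactor n (k lam : ℕ) (q lam) / DeltaXi n 0 (shift n k q)‖
      ≤ ∑ k ∈ univ.erase (fun _ => (0 : Fin n)), ‖U n k q * uFactor n (k lam : ℕ) (q lam) / DeltaXi n 0 (shift n k q)‖ :=
        norm_sum_le _ _
    _ ≤ ∑ k ∈ univ.erase (fun _ => (0 : Fin n)), 66 * ‖U n k q‖ := Finset.sum_le_sum hterm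
    _ ≤ ∑ k, 66 * ‖U n k q‖ :=
        Finset.sum_le_sum_of_subset_of_nonneg (Finset.erase_subset _ _) (fun _ _ _ => by positivity)
    _ = 66 * ∑ k, ‖U n k q‖ := by rw [Finset.mul_sum]
    _ ≤ 66 * 132 ^ d := by
        have := sum_norm_U_le n hr hq
        nlinarith

/-- `‖cfac‖ ≤ B`, `‖Rt‖ ≤ B`, `‖Δ^ξ‖ ≤ B`, `‖S₁‖ ≤ B` on `F_r`. [folklore] -/
theorem norm_cfac_le_Bc (n : ℕ) [NeZero n] {r : ℝ} (hr : r ≤ 1 / 4) {q : Fin d → ℂ} (hq : q ∈ Fat d r)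
    (lam : Fin d) : ‖cfac n lam q‖ ≤ Bc d := by
  have := norm_cfac_le n hr hq lam
  unfold Bc
  have h1 : (0 : ℝ) ≤ 16 * d := by positivity
  have h3 : (0 : ℝ) ≤ 66 * 132 ^ d := by positivity
  linarith

/-- `‖Rt‖ ≤ B` on `F_r`. [folklore] -/
theorem norm_Rt_le_Bc (n : ℕ) [NeZero n] {r : ℝ} (hr : r ≤ 1 / 4) (hdr : (d : ℝ) * r ^ 2 ≤ 1 / 16)
    {q : Fin d → ℂ} (hq : q ∈ Fat d r) (lam : Fin d) : ‖Rt n lam q‖ ≤ Bc d := by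
  have := norm_Rt_le n hr hdr hq lam
  unfold Bc
  have h1 : (0 : ℝ) ≤ 16 * d := by positivity
  have h2 : (0 : ℝ) ≤ 4 ^ (d + 1) := by positivity
  linarith

/-- `‖Δ^ξ‖ ≤ B` on `F_r`. [folklore] -/
theorem norm_DeltaXi0_le_Bc (n : ℕ) [NeZero n] {r : ℝ} (hr : r ≤ 1 / 4) {q : Fin d → ℂ} (hq : q ∈ Fat d r) :
    ‖DeltaXi n 0 q‖ ≤ Bc d := by
  have := norm_DeltaXi0_le n hr hq
  unfold Bc
  have h2 : (0 : ℝ) ≤ 4 ^ (d + 1) := by positivity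
  have h3 : (0 : ℝ) ≤ 66 * 132 ^ d := by positivity
  linarith

/-- `‖S₁(q_λ)‖ ≤ B` on `F_r`. [folklore] -/
theorem norm_S1_le_Bc {r : ℝ} (hr : r ≤ 1 / 4) {q : Fin d → ℂ} (hq : q ∈ Fat d r) (lam : Fin d) :
    ‖S1 (q lam)‖ ≤ Bc d := by
  have := norm_S1_le_16 hr (hq lam).1 (hq lam).2
  unfold Bc
  have h1 : (0 : ℝ) ≤ 16 * d := by positivity
  have h2 : (0 : ℝ) ≤ 4 ^ (d + 1) := by positivity
  have h3 : (0 : ℝ) ≤ 66 * 132 ^ d := by positivity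
  linarith

/-- `‖Y_λ‖ ≤ 2B²` on `F_r`. [folklore] -/
theorem norm_Yc_le (n : ℕ) [NeZero n] {r : ℝ} (hr : r ≤ 1 / 4) (hdr : (d : ℝ) * r ^ 2 ≤ 1 / 16)
    {q : Fin d → ℂ} (hq : q ∈ Fat d r) (lam : Fin d) : ‖Yc n lam q‖ ≤ 2 * Bc d ^ 2 := by
  unfold Yc
  have h1 := norm_cfac_le_Bc n hr hq lam
  have h2 := norm_Rt_le_Bc n hr hdr hq lam
  have h3 := norm_DeltaXi0_le_Bc n hr hq
  have hB := one_le_Bc d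
  calc ‖cfac n lam q + DeltaXi n 0 q * Rt n lam q‖
      ≤ ‖cfac n lam q‖ + ‖DeltaXi n 0 q‖ * ‖Rt n lam q‖ := by
        refine (norm_add_le _ _).trans ?_
        rw [norm_mul]
    _ ≤ Bc d + Bc d * Bc d := by
        gcongr
    _ ≤ 2 * Bc d ^ 2 := by nlinarith

/-- products of at most `d` factors each bounded by `C ≥ 1` are bounded by `C^d`. [folklore] -/
theorem norm_prod_le_pow {ι : Type*} (s : Finset ι) (f : ι → ℂ) {C : ℝ} (hC : 1 ≤ C) {m : ℕ}
    (hs : s.card ≤ m) (h : ∀ i ∈ s, ‖f i‖ ≤ C) : ‖∏ i ∈ s, f i‖ ≤ C ^ m := by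
  calc ‖∏ i ∈ s, f i‖ ≤ ∏ i ∈ s, ‖f i‖ := Finset.norm_prod_le _ _
    _ ≤ ∏ _i ∈ s, C := Finset.prod_le_prod (fun _ _ => norm_nonneg _) h
    _ = C ^ s.card := Finset.prod_const C
    _ ≤ C ^ m := pow_le_pow_right₀ hC hs

/-- the explicit fat-region bound of the denominator `F`. [folklore] -/
def MF (d : ℕ) : ℝ := Bc d ^ d + d * (Bc d * (2 ^ d * (Bc d ^ d) ^ 3))

/-- `0 < MF d`. [folklore] -/
theorem MF_pos (d : ℕ) : 0 < MF d := by
  unfold MF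
  have hB := Bc_pos d
  positivity

/-- `‖F66‖ ≤ MF d` on `F_r`. [folklore] -/
theorem norm_F66_le (n : ℕ) [NeZero n] {r : ℝ} (hr : r ≤ 1 / 4) (hdr : (d : ℝ) * r ^ 2 ≤ 1 / 16)
    {q : Fin d → ℂ} (hq : q ∈ Fat d r) : ‖F66 n q‖ ≤ MF d := by
  have hB := one_le_Bc d
  have hB0 := Bc_pos d
  have hBd : 1 ≤ Bc d ^ d := one_le_pow₀ hB
  -- the `U_0^d` term
  have hU : ‖U n (fun _ => (0 : Fin n)) q ^ d‖ ≤ Bc d ^ d := by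
    rw [norm_pow]
    refine pow_le_pow_left₀ (norm_nonneg _) ((norm_U_zero_le n hr hq).trans ?_) d
    have : (4 : ℝ) ^ d ≤ 4 ^ (d + 1) := pow_le_pow_right₀ (by norm_num) (Nat.le_succ d)
    unfold Bc
    have h1 : (0 : ℝ) ≤ 16 * d := by positivity
    have h3 : (0 : ℝ) ≤ 66 * 132 ^ d := by positivity
    linarith
  -- each `T`-summand
  have hT : ∀ lam : Fin d, ∀ T ∈ ((univ.erase lam).powerset).erase ∅,
      ‖DeltaXi n 0 q ^ (T.card - 1)
          * ((∏ lam' ∈ T, Rt n lam' q) * ∏ lam' ∈ (univ.erase lam) \ T, cfac n lam' q)‖ ≤ (Bc d ^ d) ^ 3 := by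
    intro lam T hT
    have hcardT : T.card ≤ d := (Finset.card_le_univ T).trans (by simp)
    have hcardS : ((univ.erase lam) \ T).card ≤ d := (Finset.card_le_univ _).trans (by simp)
    have e1 : ‖DeltaXi n 0 q ^ (T.card - 1)‖ ≤ Bc d ^ d := by
      rw [norm_pow]
      calc ‖DeltaXi n 0 q‖ ^ (T.card - 1) ≤ Bc d ^ (T.card - 1) :=
            pow_le_pow_left₀ (norm_nonneg _) (norm_DeltaXi0_le_Bc n hr hq) _
        _ ≤ Bc d ^ d := pow_le_pow_right₀ hB (by omega)
    have e2 : ‖∏ lam' ∈ T, Rt n lam' q‖ ≤ Bc d ^ d :=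
      norm_prod_le_pow T _ hB hcardT (fun lam' _ => norm_Rt_le_Bc n hr hdr hq lam')
    have e3 : ‖∏ lam' ∈ (univ.erase lam) \ T, cfac n lam' q‖ ≤ Bc d ^ d :=
      norm_prod_le_pow _ _ hB hcardS (fun lam' _ => norm_cfac_le_Bc n hr hq lam')
    rw [norm_mul, norm_mul]
    calc ‖DeltaXi n 0 q ^ (T.card - 1)‖ * (‖∏ lam' ∈ T, Rt n lam' q‖ * ‖∏ lam' ∈ (univ.erase lam) \ T, cfac n lam' q‖)
        ≤ Bc d ^ d * (Bc d ^ d * Bc d ^ d) := by gcongr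
      _ = (Bc d ^ d) ^ 3 := by ring
  -- the number of `T`'s
  have hcard : ∀ lam : Fin d, ((((univ.erase lam).powerset).erase ∅).card : ℝ) ≤ 2 ^ d := by
    intro lam
    have h1 : (((univ.erase lam).powerset).erase ∅).card ≤ ((univ.erase lam).powerset).card :=
      Finset.card_erase_le
    rw [Finset.card_powerset] at h1
    have h2 : 2 ^ (univ.erase lam).card ≤ 2 ^ d :=
      Nat.pow_le_pow_right (by norm_num) ((Finset.card_le_univ _).trans (by simp))
    exact_mod_cast h1.trans h2
  have hinner : ∀ lam : Fin d,
      ‖S1 (q lam) * ∑ T ∈ ((univ.erase lam).powerset).erase ∅, DeltaXi n 0 q ^ (T.card - 1)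
          * ((∏ lam' ∈ T, Rt n lam' q) * ∏ lam' ∈ (univ.erase lam) \ T, cfac n lam' q)‖
        ≤ Bc d * (2 ^ d * (Bc d ^ d) ^ 3) := by
    intro lam
    rw [norm_mul]
    refine mul_le_mul (norm_S1_le_Bc hr hq lam) ?_ (norm_nonneg _) hB0.le
    calc ‖∑ T ∈ ((univ.erase lam).powerset).erase ∅, DeltaXi n 0 q ^ (T.card - 1)
            * ((∏ lam' ∈ T, Rt n lam' q) * ∏ lam' ∈ (univ.erase lam) \ T, cfac n lam' q)‖
        ≤ ∑ T ∈ ((univ.erase lam).powerset).erase ∅, ‖DeltaXi n 0 q ^ (T.card - 1)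
            * ((∏ lam' ∈ T, Rt n lam' q) * ∏ lam' ∈ (univ.erase lam) \ T, cfac n lam' q)‖ := norm_sum_le _ _
      _ ≤ ∑ _T ∈ ((univ.erase lam).powerset).erase ∅, (Bc d ^ d) ^ 3 := Finset.sum_le_sum (hT lam)
      _ = (((univ.erase lam).powerset).erase ∅).card * (Bc d ^ d) ^ 3 := by
          rw [Finset.sum_const, nsmul_eq_mul]
      _ ≤ 2 ^ d * (Bc d ^ d) ^ 3 := by
          have := hcard lam
          have h3 : (0 : ℝ) ≤ (Bc d ^ d) ^ 3 := by positivity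
          nlinarith
  unfold F66
  calc ‖U n (fun _ => (0 : Fin n)) q ^ d + ∑ lam, S1 (q lam) * ∑ T ∈ ((univ.erase lam).powerset).erase ∅,
          DeltaXi n 0 q ^ (T.card - 1) * ((∏ lam' ∈ T, Rt n lam' q) * ∏ lam' ∈ (univ.erase lam) \ T, cfac n lam' q)‖
      ≤ ‖U n (fun _ => (0 : Fin n)) q ^ d‖ + ∑ lam, ‖S1 (q lam) * ∑ T ∈ ((univ.erase lam).powerset).erase ∅,
          DeltaXi n 0 q ^ (T.card - 1) * ((∏ lam' ∈ T, Rt n lam' q) * ∏ lam' ∈ (univ.erase lam) \ T, cfac n lam' q)‖ :=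
        (norm_add_le _ _).trans (add_le_add le_rfl (norm_sum_le _ _))
    _ ≤ Bc d ^ d + ∑ _lam : Fin d, Bc d * (2 ^ d * (Bc d ^ d) ^ 3) := add_le_add hU (Finset.sum_le_sum fun lam _ => hinner lam)
    _ = MF d := by
        rw [Finset.sum_const, Finset.card_univ, Fintype.card_fin, nsmul_eq_mul]
        rfl

/-- `‖Π_{λ∉{μ,ν}} Y_λ‖ ≤ (2B²)^d` on `F_r`. [folklore] -/
theorem norm_prodYc_le (n : ℕ) [NeZero n] {r : ℝ} (hr : r ≤ 1 / 4) (hdr : (d : ℝ) * r ^ 2 ≤ 1 / 16)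
    {q : Fin d → ℂ} (hq : q ∈ Fat d r) (μ ν : Fin d) :
    ‖∏ lam ∈ (univ.erase μ).erase ν, Yc n lam q‖ ≤ (2 * Bc d ^ 2) ^ d := by
  have hB := one_le_Bc d
  refine norm_prod_le_pow _ _ (by nlinarith) ((Finset.card_le_univ _).trans (by simp))
    (fun lam _ => norm_Yc_le n hr hdr hq lam)

/-! ### §2 Joint holomorphy on the fat region -/

/-- every residue factor `u_n(j;·)`, `j < n`, is holomorphic at the points of the fat box. [folklore] -/
theorem differentiableAt_uFactor_fin (n : ℕ) [NeZero n] (j : Fin n) {r : ℝ} (hr : r ≤ 1 / 4) {z : ℂ}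
    (hx : |z.re| ≤ Real.pi + r) : DifferentiableAt ℂ (uFactor n (j : ℕ)) z := by
  have hn : 1 ≤ n := Nat.one_le_iff_ne_zero.mpr (NeZero.ne n)
  have hπ := Real.pi_gt_three
  by_cases hj : (j : ℕ) = 0
  · rw [hj]
    exact differentiableAt_uFactor_zero n hn (by linarith [hr])
  · exact differentiableAt_uFactor_ne n _ hj
      (Sxi_shift_ne_zero n _ (Nat.one_le_iff_ne_zero.mpr hj) j.isLt hr hx)

/-- `cfac` is jointly holomorphic on `F_r`. [folklore] -/
theorem differentiableAt_cfac (n : ℕ) [NeZero n] {r : ℝ} (hr : r ≤ 1 / 4) {q : Fin d → ℂ} (hq : q ∈ Fat d r)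
    (lam : Fin d) : DifferentiableAt ℂ (fun p : Fin d → ℂ => cfac n lam p) q := by
  have hn : 1 ≤ n := Nat.one_le_iff_ne_zero.mpr (NeZero.ne n)
  have hπ := Real.pi_gt_three
  unfold cfac
  refine (differentiableAt_U n hr hq _).mul ?_
  have hF : DifferentiableAt ℂ (uFactor n 0) (q lam) :=
    differentiableAt_uFactor_zero n hn (by linarith [(hq lam).1, hr])
  exact hF.comp q (differentiableAt_apply (𝕜 := ℂ) lam q)

/-- `Rt` is jointly holomorphic on `F_r` (shifted denominators do not vanish there). [folklore] -/
theorem differentiableAt_Rt (n : ℕ) [NeZero n] {r : ℝ} (hr : r ≤ 1 / 4) (hdr : (d : ℝ) * r ^ 2 ≤ 1 / 16)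
    {q : Fin d → ℂ} (hq : q ∈ Fat d r) (lam : Fin d) :
    DifferentiableAt ℂ (fun p : Fin d → ℂ => Rt n lam p) q := by
  unfold Rt
  refine DifferentiableAt.fun_sum (fun k hk => ?_)
  have hk0 : k ≠ fun _ => 0 := Finset.ne_of_mem_erase hk
  have hΔ : DeltaXi n 0 (shift n k q) ≠ 0 := by
    intro h
    have := norm_DeltaXi_shift_ge n 0 le_rfl hr hdr hq k hk0
    rw [h, norm_zero] at this
    linarith
  refine dAt_div ?_ (differentiableAt_DeltaXi_shift n 0 k q) hΔ
  refine (differentiableAt_U n hr hq k).mul ?_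
  exact (differentiableAt_uFactor_fin n (k lam) hr (hq lam).1).comp q (differentiableAt_apply (𝕜 := ℂ) lam q)

/-- `Y_λ` is jointly holomorphic on `F_r`. [folklore] -/
theorem differentiableAt_Yc (n : ℕ) [NeZero n] {r : ℝ} (hr : r ≤ 1 / 4) (hdr : (d : ℝ) * r ^ 2 ≤ 1 / 16)
    {q : Fin d → ℂ} (hq : q ∈ Fat d r) (lam : Fin d) :
    DifferentiableAt ℂ (fun p : Fin d → ℂ => Yc n lam p) q := by
  unfold Yc
  exact (differentiableAt_cfac n hr hq lam).add
    ((differentiableAt_DeltaXi n 0 q).mul (differentiableAt_Rt n hr hdr hq lam))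

/-- `F` is jointly holomorphic on `F_r`. [folklore] -/
theorem differentiableAt_F66 (n : ℕ) [NeZero n] {r : ℝ} (hr : r ≤ 1 / 4) (hdr : (d : ℝ) * r ^ 2 ≤ 1 / 16)
    {q : Fin d → ℂ} (hq : q ∈ Fat d r) : DifferentiableAt ℂ (fun p : Fin d → ℂ => F66 n p) q := by
  unfold F66
  refine ((differentiableAt_U n hr hq _).pow d).add ?_
  refine DifferentiableAt.fun_sum (fun lam _ => ?_)
  refine ((differentiable_S1 _).comp q (differentiableAt_apply (𝕜 := ℂ) lam q)).mul ?_
  refine DifferentiableAt.fun_sum (fun T _ => ?_)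
  refine ((differentiableAt_DeltaXi n 0 q).pow _).mul ?_
  exact (dAt_finset_prod T _ q (fun lam' _ => differentiableAt_Rt n hr hdr hq lam')).mul
    (dAt_finset_prod _ _ q (fun lam' _ => differentiableAt_cfac n hr hq lam'))

/-- `Π_{λ∉{μ,ν}} Y_λ` is jointly holomorphic on `F_r`. [folklore] -/
theorem differentiableAt_prodYc (n : ℕ) [NeZero n] {r : ℝ} (hr : r ≤ 1 / 4) (hdr : (d : ℝ) * r ^ 2 ≤ 1 / 16)
    {q : Fin d → ℂ} (hq : q ∈ Fat d r) (μ ν : Fin d) :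
    DifferentiableAt ℂ (fun p : Fin d → ℂ => ∏ lam ∈ (univ.erase μ).erase ν, Yc n lam p) q :=
  dAt_finset_prod _ _ q (fun lam _ => differentiableAt_Yc n hr hdr hq lam)

/-- `W_{μν} = Π Y / F` is jointly holomorphic at the fat points where `F ≠ 0`. [folklore] -/
theorem differentiableAt_W166 (n : ℕ) [NeZero n] {r : ℝ} (hr : r ≤ 1 / 4) (hdr : (d : ℝ) * r ^ 2 ≤ 1 / 16)
    {q : Fin d → ℂ} (hq : q ∈ Fat d r) (μ ν : Fin d) (hF : F66 n q ≠ 0) :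
    DifferentiableAt ℂ (fun p : Fin d → ℂ => W166 n μ ν p) q := by
  unfold W166
  exact dAt_div (differentiableAt_prodYc n hr hdr hq μ ν) (differentiableAt_F66 n hr hdr hq) hF

/-! ### §3 The zero-free strip for the denominator `F` -/

/-- on real momenta `‖F‖ ≥ ((4/π²)^d)^d` (`B5Symbol166.F66r_lower`). [folklore] -/
theorem norm_F66_real_ge (n : ℕ) [NeZero n] (s : Fin d → ℝ) (hs : ∀ μ, |s μ| ≤ Real.pi) :
    ((4 / Real.pi ^ 2) ^ d) ^ d ≤ ‖F66 n (ofRealVec s)‖ := by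
  have hn : 1 ≤ n := Nat.one_le_iff_ne_zero.mpr (NeZero.ne n)
  rw [F66_ofReal, Complex.norm_real, Real.norm_eq_abs]
  exact (F66r_lower n hn s hs).trans (le_abs_self _)

/-- the strip half-width of this file: `κ₁₆₆(d) = min(r, c·r/(MF·(d+1)))`, `c = ((4/π²)^d)^d/2`, `r = rOf d` —
depends on `d` only. [folklore] -/
def kappa166 (d : ℕ) : ℝ :=
  min (rOf d) (((4 / Real.pi ^ 2) ^ d) ^ d / 2 * rOf d / (MF d * ((d : ℝ) + 1)))

/-- `0 < κ₁₆₆(d)`. [folklore] -/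
theorem kappa166_pos (d : ℕ) : 0 < kappa166 d := by
  unfold kappa166
  have h1 := rOf_pos d
  have h2 := MF_pos d
  have h3 : (0 : ℝ) < ((4 / Real.pi ^ 2) ^ d) ^ d / 2 := by positivity
  exact lt_min h1 (by positivity)

/-- `κ₁₆₆(d) ≤ r`. [folklore] -/
theorem kappa166_le_rOf (d : ℕ) : kappa166 d ≤ rOf d := min_le_left _ _

/-- **THE ZERO-FREE STRIP**: for `0 ≤ κ ≤ κ₁₆₆(d)` and every `n ≥ 1`, `‖F(p)‖ ≥ ((4/π²)^d)^d/2` on `Strip d κ`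
(real lower bound + imaginary-direction Lipschitz bound from the Cauchy estimate on the fat region). [folklore] -/
theorem F66_lower (n : ℕ) [NeZero n] {κ : ℝ} (hκ0 : 0 ≤ κ) (hκ : κ ≤ kappa166 d) :
    ∀ p ∈ Strip d κ, ((4 / Real.pi ^ 2) ^ d) ^ d / 2 ≤ ‖F66 n p‖ := by
  have hr := rOf_pos d
  have hκr : κ ≤ rOf d := hκ.trans (kappa166_le_rOf d)
  have hMF := MF_pos d
  set c : ℝ := ((4 / Real.pi ^ 2) ^ d) ^ d / 2 with hc
  have hc0 : 0 < c := by positivity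
  have hdiff : ∀ q ∈ Fat d (rOf d), ∀ μ, DifferentiableAt ℂ (fun w => F66 n (Function.update q μ w)) (q μ) := by
    intro q hq μ
    have h := differentiableAt_F66 n (rOf_le d) (d_mul_rOf_sq_le d) hq
    rw [← Function.update_eq_self μ q] at h
    exact h.comp (q μ) (differentiableAt_update q μ (q μ))
  have hlip := imLipschitz_of_fat (F66 n) hr hκ0 hκr hdiff
    (fun q hq => norm_F66_le n (rOf_le d) (d_mul_rOf_sq_le d) hq)
  refine strip_lower_bound (F66 n) c (MF d / rOf d) κ ?_ hlip (by positivity) ?_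
  · intro s hs
    rw [hc]
    have := norm_F66_real_ge n s hs
    linarith
  · have hκ2 : κ ≤ c * rOf d / (MF d * ((d : ℝ) + 1)) := hκ.trans (min_le_right _ _)
    have hd : (0 : ℝ) ≤ d := Nat.cast_nonneg d
    calc MF d / rOf d * (d * κ) ≤ MF d / rOf d * (d * (c * rOf d / (MF d * ((d : ℝ) + 1)))) := by
          gcongr
      _ = c * (d / ((d : ℝ) + 1)) := by field_simp
      _ ≤ c * 1 := by
          gcongr
          rw [div_le_one (by positivity)]
          linarith
      _ = c := mul_one c

/-- `F ≠ 0` on the zero-free strip. [folklore] -/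
theorem F66_ne_zero_of_mem (n : ℕ) [NeZero n] {κ : ℝ} (hκ0 : 0 ≤ κ) (hκ : κ ≤ kappa166 d)
    {p : Fin d → ℂ} (hp : p ∈ Strip d κ) : F66 n p ≠ 0 := by
  intro h
  have := F66_lower n hκ0 hκ p hp
  rw [h, norm_zero] at this
  have h3 : (0 : ℝ) < ((4 / Real.pi ^ 2) ^ d) ^ d / 2 := by positivity
  linarith

/-! ### §4 Periodicity of `W_{μν}` across the strip sides -/

/-- the FULL residue sum `A_λ(p) = Σ_k U_k(p) u_n(k_λ; p_λ)/Δ^ξ_k(p)` (`= cfac/Δ + Rt`; on reals `= Δ₀φ_λ`). [folklore] -/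
def Afac (n : ℕ) [NeZero n] (lam : Fin d) (p : Fin d → ℂ) : ℂ :=
  ∑ k : Fin d → Fin n, U n k p * uFactor n (k lam : ℕ) (p lam) / DeltaXi n 0 (shift n k p)

/-- `Y_λ = Δ · A_λ` where `Δ ≠ 0`. [folklore] -/
theorem Yc_eq_DeltaXi_mul_Afac (n : ℕ) [NeZero n] (lam : Fin d) (p : Fin d → ℂ) (h : DeltaXi n 0 p ≠ 0) :
    Yc n lam p = DeltaXi n 0 p * Afac n lam p := by
  unfold Yc Afac cfac Rt
  rw [← Finset.add_sum_erase _ _ (Finset.mem_univ (fun _ => (0 : Fin n))), mul_add]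
  simp only [shift_zero, Fin.val_zero]
  field_simp

/-- the extra residue factor relabels like `U`: `u_n(k_λ; (p + 2πe_i)_λ) = u_n((σ_i k)_λ; p_λ)` (`p_i ∉ {0, −2π}`).
[folklore] -/
theorem uFactor_coord_tr (n : ℕ) [NeZero n] (k : Fin d → Fin n) (p : Fin d → ℂ) (i lam : Fin d)
    (hz : p i ≠ 0) (hz' : p i + 2 * Real.pi ≠ 0) :
    uFactor n (k lam : ℕ) (tr p i lam) = uFactor n (sigma n i k lam : ℕ) (p lam) := by
  by_cases h : lam = i
  · subst h
    rw [tr_apply_self, sigma_apply_self]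
    exact uFactor_add_two_pi n (k lam) hz hz'
  · rw [tr_apply_of_ne h, sigma_apply_of_ne n h]

/-- `A_λ` is `2π`-periodic in each coordinate (off `p_i ∈ {0, −2π}`): relabel the residues by `σ_i`. [folklore] -/
theorem Afac_tr (n : ℕ) [NeZero n] (lam : Fin d) (p : Fin d → ℂ) (i : Fin d) (hz : p i ≠ 0)
    (hz' : p i + 2 * Real.pi ≠ 0) : Afac n lam (tr p i) = Afac n lam p := by
  unfold Afac
  simp_rw [U_tr n _ p i hz hz', DeltaXi_shift_tr n 0 _ p i, uFactor_coord_tr n _ p i lam hz hz']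
  exact Equiv.sum_comp (sigmaEquiv n i)
    (fun k => U n k p * uFactor n (k lam : ℕ) (p lam) / DeltaXi n 0 (shift n k p))

/-- QUASI-PERIODICITY OF `Y_λ`: `Y_λ(p + 2πe_i)·Δ(p) = Δ(p + 2πe_i)·Y_λ(p)` (both `Δ`'s nonzero, `p_i ∉ {0, −2π}`).
[folklore] -/
theorem Yc_tr_mul (n : ℕ) [NeZero n] (lam : Fin d) (p : Fin d → ℂ) (i : Fin d) (hz : p i ≠ 0)
    (hz' : p i + 2 * Real.pi ≠ 0) (h0 : DeltaXi n 0 p ≠ 0) (h1 : DeltaXi n 0 (tr p i) ≠ 0) :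
    Yc n lam (tr p i) * DeltaXi n 0 p = DeltaXi n 0 (tr p i) * Yc n lam p := by
  rw [Yc_eq_DeltaXi_mul_Afac n lam _ h1, Yc_eq_DeltaXi_mul_Afac n lam _ h0, Afac_tr n lam p i hz hz']
  ring

/-- products of `Y`'s: `(Π_{S} Y_λ(p + 2πe_i))·Δ(p)^{|S|} = Δ(p + 2πe_i)^{|S|}·Π_S Y_λ(p)`. [folklore] -/
theorem prodYc_tr_mul (n : ℕ) [NeZero n] (S : Finset (Fin d)) (p : Fin d → ℂ) (i : Fin d) (hz : p i ≠ 0)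
    (hz' : p i + 2 * Real.pi ≠ 0) (h0 : DeltaXi n 0 p ≠ 0) (h1 : DeltaXi n 0 (tr p i) ≠ 0) :
    (∏ lam ∈ S, Yc n lam (tr p i)) * DeltaXi n 0 p ^ S.card
      = DeltaXi n 0 (tr p i) ^ S.card * ∏ lam ∈ S, Yc n lam p := by
  rw [← Finset.prod_const, ← Finset.prod_mul_distrib, ← Finset.prod_const, ← Finset.prod_mul_distrib]
  exact Finset.prod_congr rfl (fun lam _ => Yc_tr_mul n lam p i hz hz' h0 h1)

/-- `S₁` does not see the translate: `S₁((p + 2πe_i)_λ) = S₁(p_λ)`. [folklore] -/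
theorem S1_coord_tr (p : Fin d → ℂ) (i lam : Fin d) : S1 (tr p i lam) = S1 (p lam) := by
  by_cases h : lam = i
  · subst h
    rw [tr_apply_self, S1_add_two_pi]
  · rw [tr_apply_of_ne h]

/-- QUASI-PERIODICITY OF `E`: `E(p + 2πe_i)·Δ(p)^{d−1} = Δ(p + 2πe_i)^{d−1}·E(p)`. [folklore] -/
theorem E66_tr_mul (n : ℕ) [NeZero n] (p : Fin d → ℂ) (i : Fin d) (hz : p i ≠ 0)
    (hz' : p i + 2 * Real.pi ≠ 0) (h0 : DeltaXi n 0 p ≠ 0) (h1 : DeltaXi n 0 (tr p i) ≠ 0) :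
    E66 n (tr p i) * DeltaXi n 0 p ^ (d - 1) = DeltaXi n 0 (tr p i) ^ (d - 1) * E66 n p := by
  unfold E66
  rw [Finset.sum_mul, Finset.mul_sum]
  refine Finset.sum_congr rfl (fun lam _ => ?_)
  have hcard : (univ.erase lam).card = d - 1 := by
    rw [Finset.card_erase_of_mem (Finset.mem_univ lam), Finset.card_univ, Fintype.card_fin]
  have h := prodYc_tr_mul n (univ.erase lam) p i hz hz' h0 h1
  rw [hcard] at h
  rw [S1_coord_tr, mul_assoc, h]
  ring

/-- QUASI-PERIODICITY OF `F` (through `E = Δ·F`):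
`Δ(p + 2πe_i)·F(p + 2πe_i)·Δ(p)^{d−1} = Δ(p + 2πe_i)^{d−1}·Δ(p)·F(p)`. [folklore] -/
theorem F66_tr_mul (n : ℕ) [NeZero n] (p : Fin d → ℂ) (i : Fin d) (hz : p i ≠ 0)
    (hz' : p i + 2 * Real.pi ≠ 0) (h0 : DeltaXi n 0 p ≠ 0) (h1 : DeltaXi n 0 (tr p i) ≠ 0) :
    DeltaXi n 0 (tr p i) * F66 n (tr p i) * DeltaXi n 0 p ^ (d - 1)
      = DeltaXi n 0 (tr p i) ^ (d - 1) * (DeltaXi n 0 p * F66 n p) := by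
  rw [← E66_eq_mul, ← E66_eq_mul]
  exact E66_tr_mul n p i hz hz' h0 h1

/-- two distinct indices force `d ≥ 2`. [folklore] -/
theorem two_le_of_ne {μ ν : Fin d} (h : μ ≠ ν) : 2 ≤ d := by
  rcases Nat.lt_or_ge d 2 with hd | hd
  · interval_cases d
    · exact μ.elim0
    · exact absurd (Subsingleton.elim μ ν) h
  · exact hd

/-- the four side conditions at an edge point of a thin strip: `p_i ≠ 0`, `p_i + 2π ≠ 0`, `Δ(p) ≠ 0`,
`Δ(p + 2πe_i) ≠ 0` (`κ ≤ 1`, `dκ² ≤ 1/16`; `B5Strip145Analytic.re_DeltaXi_pos_of_edge`). [folklore] -/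
theorem edge_conditions (n : ℕ) [NeZero n] {κ : ℝ} (hκ1 : κ ≤ 1) (hdκ : (d : ℝ) * κ ^ 2 ≤ 1 / 16)
    {p : Fin d → ℂ} (hp : p ∈ Strip d κ) (i : Fin d) (hre : (p i).re = -Real.pi) :
    p i ≠ 0 ∧ p i + 2 * Real.pi ≠ 0 ∧ DeltaXi n 0 p ≠ 0 ∧ DeltaXi n 0 (tr p i) ≠ 0 := by
  have hπ := Real.pi_pos
  refine ⟨?_, ?_, ?_, ?_⟩
  · intro h; rw [h, Complex.zero_re] at hre; linarith
  · intro h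
    have := congrArg Complex.re h
    rw [← tr_apply_self, tr_re_self, hre, Complex.zero_re] at this
    linarith
  · intro h
    have := re_DeltaXi_pos_of_edge n 0 le_rfl hκ1 hdκ (fun ν => (hp ν).2) i
      (by rw [hre, abs_neg, abs_of_pos hπ])
    rw [h, Complex.zero_re] at this
    linarith
  · intro h
    have := re_DeltaXi_pos_of_edge n 0 le_rfl hκ1 hdκ (q := tr p i)
      (fun ν => by rw [tr_im]; exact (hp ν).2) i (by rw [tr_re_self, hre]; ring_nf; exact abs_of_pos hπ)
    rw [h, Complex.zero_re] at this
    linarith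

/-- **PERIODICITY OF THE (1.66) SYMBOL ACROSS THE STRIP SIDES**: for `p ∈ Strip d κ` (`0 ≤ κ ≤ κ₁₆₆(d)`) with
`Re p_i = −π` and `μ ≠ ν`:  `W_{μν}(p + 2πe_i) = W_{μν}(p)`.  The numerator picks up `(Δ(tr p)/Δ(p))^{d−2}`, the
denominator `F = E/Δ` the same factor; cross-multiplied, no division by `Δ` is performed. [folklore] -/
theorem W166_tr (n : ℕ) [NeZero n] {κ : ℝ} (hκ0 : 0 ≤ κ) (hκ : κ ≤ kappa166 d) {p : Fin d → ℂ}
    (hp : p ∈ Strip d κ) (i : Fin d) (hre : (p i).re = -Real.pi) {μ ν : Fin d} (hμν : μ ≠ ν) :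
    W166 n μ ν (tr p i) = W166 n μ ν p := by
  have hd := two_le_of_ne hμν
  obtain ⟨hκ1, hdκ⟩ := kappa_small hκ0 (hκ.trans (kappa166_le_rOf d))
  obtain ⟨hz, hz', h0, h1⟩ := edge_conditions n hκ1 hdκ hp i hre
  have hpt : tr p i ∈ Strip d κ := by
    -- (the translate of the left side point is the right side point; cf. `B4StripSums.tr_mem_Strip`)
    intro ν'
    by_cases h : ν' = i
    · subst h
      refine ⟨?_, by rw [tr_im]; exact (hp ν').2⟩
      rw [tr_re_self, hre]
      ring_nf
      rw [abs_of_pos Real.pi_pos]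
    · rw [tr_apply_of_ne h]; exact hp ν'
  have hFp : F66 n p ≠ 0 := F66_ne_zero_of_mem n hκ0 hκ hp
  have hFt : F66 n (tr p i) ≠ 0 := F66_ne_zero_of_mem n hκ0 hκ hpt
  have hν : ν ∈ univ.erase μ := Finset.mem_erase.mpr ⟨hμν.symm, Finset.mem_univ ν⟩
  have hcard : ((univ.erase μ).erase ν).card = d - 2 := by
    rw [Finset.card_erase_of_mem hν, Finset.card_erase_of_mem (Finset.mem_univ μ), Finset.card_univ,
      Fintype.card_fin]
    omega
  have hP := prodYc_tr_mul n ((univ.erase μ).erase ν) p i hz hz' h0 h1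
  rw [hcard] at hP
  have hF := F66_tr_mul n p i hz hz' h0 h1
  have hd1 : d - 1 = (d - 2) + 1 := by omega
  rw [hd1] at hF
  unfold W166
  rw [div_eq_div_iff hFt hFp]
  have hX : DeltaXi n 0 p ^ (d - 2 + 1) * DeltaXi n 0 (tr p i) ^ (d - 2 + 1) ≠ 0 :=
    mul_ne_zero (pow_ne_zero _ h0) (pow_ne_zero _ h1)
  refine mul_right_cancel₀ hX ?_
  linear_combination (F66 n p * DeltaXi n 0 p * DeltaXi n 0 (tr p i) ^ (d - 2 + 1)) * hP
    - ((∏ lam ∈ (univ.erase μ).erase ν, Yc n lam p) * DeltaXi n 0 (tr p i) ^ (d - 2)) * hF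

/-! ### §5 The strip-regular package (dimension `d + 1`, as the engines want it) -/

/-- the explicit strip bound of `W_{μν}`: numerator bound over denominator lower bound. [folklore] -/
def MW (d : ℕ) : ℝ := (2 * Bc d ^ 2) ^ d / (((4 / Real.pi ^ 2) ^ d) ^ d / 2)

/-- `0 < MW d`. [folklore] -/
theorem MW_pos (d : ℕ) : 0 < MW d := by
  unfold MW
  have := Bc_pos d
  positivity

/-- `‖W_{μν}‖ ≤ MW d` on the zero-free strip. [folklore] -/
theorem norm_W166_le (n : ℕ) [NeZero n] {κ : ℝ} (hκ0 : 0 ≤ κ) (hκ : κ ≤ kappa166 d) {p : Fin d → ℂ}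
    (hp : p ∈ Strip d κ) (μ ν : Fin d) : ‖W166 n μ ν p‖ ≤ MW d := by
  have hκr : κ ≤ rOf d := hκ.trans (kappa166_le_rOf d)
  have hfat : p ∈ Fat d (rOf d) := strip_subset_fat (rOf_pos d).le hκr hp
  have hlow := F66_lower n hκ0 hκ p hp
  have hc : (0 : ℝ) < ((4 / Real.pi ^ 2) ^ d) ^ d / 2 := by positivity
  unfold W166 MW
  rw [norm_div]
  rw [div_le_div_iff₀ (lt_of_lt_of_le hc hlow) hc]
  exact mul_le_mul (norm_prodYc_le n (rOf_le d) (d_mul_rOf_sq_le d) hfat μ ν) hlow hc.le (by positivity)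

/-- **STRIP REGULARITY OF THE (1.66) SYMBOL** `W_{μν}` (`μ ≠ ν`) on `ℂ^{d+1}`: continuous on the closed strip,
holomorphic in every coordinate slice, matching vertical sides, bounded by `MW (d+1)` — for EVERY `n ≥ 1` and every
`0 ≤ κ ≤ κ₁₆₆(d+1)`. [folklore] -/
theorem stripRegular_W166 (n : ℕ) [NeZero n] {κ : ℝ} (hκ0 : 0 ≤ κ) (hκ : κ ≤ kappa166 (d + 1))
    {μ ν : Fin (d + 1)} (hμν : μ ≠ ν) :
    StripRegular (d := d) (fun p : Fin (d + 1) → ℂ => W166 n μ ν p) κ (MW (d + 1)) := by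
  have hκr : κ ≤ rOf (d + 1) := hκ.trans (kappa166_le_rOf _)
  have hfat : Strip (d + 1) κ ⊆ Fat (d + 1) (rOf (d + 1)) := strip_subset_fat (rOf_pos _).le hκr
  have hdiffAt : ∀ p ∈ Strip (d + 1) κ, DifferentiableAt ℂ (fun q : Fin (d + 1) → ℂ => W166 n μ ν q) p :=
    fun p hp => differentiableAt_W166 n (rOf_le _) (d_mul_rOf_sq_le _) (hfat hp) μ ν
      (F66_ne_zero_of_mem n hκ0 hκ hp)
  refine ⟨?_, ?_, ?_, ?_⟩
  · exact fun p hp => (hdiffAt p hp).continuousAt.continuousWithinAt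
  · intro i q hq z hz
    have hP : i.insertNth z (ofRealVec q) ∈ Strip (d + 1) κ :=
      insertNth_mem_Strip hκ0 i hq (openRect_subset_closedRect κ hz)
    exact ((hdiffAt _ hP).comp z (differentiableAt_insertNth i _ z)).differentiableWithinAt
  · intro i q hq y hy
    obtain ⟨hP, hre⟩ := insertNth_left_mem hκ0 i hq hy
    show W166 n μ ν _ = W166 n μ ν _
    rw [← tr_insertNth_left]
    exact (W166_tr n hκ0 hκ hP i hre hμν).symm
  · exact fun p hp => norm_W166_le n hκ0 hκ hp μ ν

/-! ### §6 The entire factors `e^{∓ip_a} − 1` and the matrix-entry symbol `Gsym` -/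

/-- the continuation of `conj ∂¹_a(p′) = e^{−ip′_a} − 1`. [folklore] -/
def expFacNeg (a : Fin d) (p : Fin d → ℂ) : ℂ := Complex.exp (-(p a * I)) - 1

/-- the continuation of `∂¹_b(p′) = e^{ip′_b} − 1` (`B5Prop11Fiber.d1Sym`). [folklore] -/
def expFacPos (b : Fin d) (p : Fin d → ℂ) : ℂ := Complex.exp (p b * I) - 1

/-- on real momenta `e^{ip_b} − 1 = ∂¹_b(p)`. [folklore] -/
theorem expFacPos_ofReal (b : Fin d) (s : Fin d → ℝ) : expFacPos b (ofRealVec s) = d1Sym s b := by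
  simp [expFacPos, d1Sym, ofRealVec]

/-- on real momenta `e^{−ip_a} − 1 = conj ∂¹_a(p)`. [folklore] -/
theorem expFacNeg_ofReal (a : Fin d) (s : Fin d → ℝ) :
    expFacNeg a (ofRealVec s) = (starRingEnd ℂ) (d1Sym s a) := by
  simp only [expFacNeg, d1Sym, ofRealVec, map_sub, map_one, ← Complex.exp_conj, map_mul, Complex.conj_ofReal,
    Complex.conj_I, mul_neg]

/-- the bound `e^κ + 1` of the exponential factors on the strip. [folklore] -/
theorem norm_expFac_le {κ : ℝ} {p : Fin d → ℂ} (hp : p ∈ Strip d κ) (a : Fin d) :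
    ‖expFacNeg a p‖ ≤ Real.exp κ + 1 ∧ ‖expFacPos a p‖ ≤ Real.exp κ + 1 := by
  have him := (hp a).2
  have h1 : ‖Complex.exp (-(p a * I))‖ ≤ Real.exp κ := by
    rw [Complex.norm_exp]
    apply Real.exp_le_exp.mpr
    simp only [neg_re, mul_re, I_re, mul_zero, I_im, mul_one, zero_sub, neg_neg]
    exact (le_abs_self _).trans him
  have h2 : ‖Complex.exp (p a * I)‖ ≤ Real.exp κ := by
    rw [Complex.norm_exp]
    apply Real.exp_le_exp.mpr
    simp only [mul_re, I_re, mul_zero, I_im, mul_one, zero_sub]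
    exact (neg_le_abs _).trans him
  refine ⟨?_, ?_⟩
  · unfold expFacNeg
    exact (norm_sub_le _ _).trans (by simpa using h1)
  · unfold expFacPos
    exact (norm_sub_le _ _).trans (by simpa using h2)

/-- `e^{−i(z + 2π)} = e^{−iz}`, `e^{i(z + 2π)} = e^{iz}`. [folklore] -/
theorem exp_neg_add_two_pi_mul_I (z : ℂ) : Complex.exp (-((z + 2 * Real.pi) * I)) = Complex.exp (-(z * I)) := by
  rw [show -((z + 2 * Real.pi) * I) = -(z * I) - 2 * Real.pi * I by ring, Complex.exp_sub,
    Complex.exp_two_pi_mul_I, div_one]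

/-- `e^{i(z + 2π)} = e^{iz}`. [folklore] -/
theorem exp_add_two_pi_mul_I (z : ℂ) : Complex.exp ((z + 2 * Real.pi) * I) = Complex.exp (z * I) := by
  rw [show (z + 2 * Real.pi) * I = z * I + 2 * Real.pi * I by ring, Complex.exp_add,
    Complex.exp_two_pi_mul_I, mul_one]

/-- the exponential factors are `2π`-periodic in every coordinate. [folklore] -/
theorem expFacNeg_periodic (a i : Fin d) (p : Fin d → ℂ) :
    expFacNeg a (Function.update p i (p i + 2 * Real.pi)) = expFacNeg a p := by
  unfold expFacNeg
  by_cases h : a = i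
  · subst h; rw [Function.update_self, exp_neg_add_two_pi_mul_I]
  · rw [Function.update_of_ne h]

/-- `e^{ip_b} − 1` is `2π`-periodic in every coordinate. [folklore] -/
theorem expFacPos_periodic (b i : Fin d) (p : Fin d → ℂ) :
    expFacPos b (Function.update p i (p i + 2 * Real.pi)) = expFacPos b p := by
  unfold expFacPos
  by_cases h : b = i
  · subst h; rw [Function.update_self, exp_add_two_pi_mul_I]
  · rw [Function.update_of_ne h]

/-- `e^{−ip_a} − 1` is entire. [folklore] -/
theorem differentiable_expFacNeg (a : Fin d) : Differentiable ℂ (fun p : Fin d → ℂ => expFacNeg a p) := by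
  unfold expFacNeg
  exact (((differentiable_apply (𝕜 := ℂ) a).mul_const I).neg.cexp).sub_const 1

/-- `e^{ip_b} − 1` is entire. [folklore] -/
theorem differentiable_expFacPos (b : Fin d) : Differentiable ℂ (fun p : Fin d → ℂ => expFacPos b p) := by
  unfold expFacPos
  exact (((differentiable_apply (𝕜 := ℂ) b).mul_const I).cexp).sub_const 1

/-- the exponential factors are strip regular (entire, `2π`-periodic, bounded by `e^κ + 1`). [folklore] -/
theorem stripRegular_expFacNeg (a : Fin (d + 1)) (κ : ℝ) :
    StripRegular (d := d) (fun p => expFacNeg a p) κ (Real.exp κ + 1) := by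
  have hd := differentiable_expFacNeg (d := d + 1) a
  refine ⟨hd.continuous.continuousOn, ?_, ?_, ?_⟩
  · intro i q _
    exact (hd.comp (fun z => differentiableAt_insertNth i (ofRealVec q) z)).differentiableOn
  · intro i q _ y _
    exact sides_of_periodic (fun p => expFacNeg a p) (fun j p => expFacNeg_periodic a j p) i q y
  · exact fun p hp => (norm_expFac_le hp a).1

/-- `e^{ip_b} − 1` is strip regular with bound `e^κ + 1`. [folklore] -/
theorem stripRegular_expFacPos (b : Fin (d + 1)) (κ : ℝ) :
    StripRegular (d := d) (fun p => expFacPos b p) κ (Real.exp κ + 1) := by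
  have hd := differentiable_expFacPos (d := d + 1) b
  refine ⟨hd.continuous.continuousOn, ?_, ?_, ?_⟩
  · intro i q _
    exact (hd.comp (fun z => differentiableAt_insertNth i (ofRealVec q) z)).differentiableOn
  · intro i q _ y _
    exact sides_of_periodic (fun p => expFacPos b p) (fun j p => expFacPos_periodic b j p) i q y
  · exact fun p hp => (norm_expFac_le hp b).2

/-- THE MATRIX-ENTRY SYMBOL of the (1.66) operator between unit forms at bonds of directions `a`, `b`:
`G^{ab}_{μν}(p) = ½ · W_{μν}(p) · (e^{−ip_a} − 1)(e^{ip_b} − 1)` (the continuation of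
`½ w_{μν}(p′) conj ∂¹_a(p′) ∂¹_b(p′)`). [folklore] -/
def Gsym (n : ℕ) [NeZero n] (μ ν a b : Fin d) (p : Fin d → ℂ) : ℂ :=
  1 / 2 * W166 n μ ν p * (expFacNeg a p * expFacPos b p)

/-- the explicit strip bound of `Gsym`: `½ · MW · 16` (uses `e^κ + 1 ≤ 4` for `κ ≤ 1`). [folklore] -/
def MG (d : ℕ) : ℝ := 1 / 2 * MW d * 16

/-- `0 < MG d`. [folklore] -/
theorem MG_pos (d : ℕ) : 0 < MG d := by
  unfold MG; have := MW_pos d; positivity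

/-- **STRIP REGULARITY OF THE ENTRY SYMBOL**: `Gsym n μ ν a b` is strip regular on `Strip (d+1) κ` with the bound
`MG (d+1)`, for every `n ≥ 1`, `μ ≠ ν`, `0 ≤ κ ≤ κ₁₆₆(d+1)`. [folklore] -/
theorem stripRegular_Gsym (n : ℕ) [NeZero n] {κ : ℝ} (hκ0 : 0 ≤ κ) (hκ : κ ≤ kappa166 (d + 1))
    {μ ν : Fin (d + 1)} (hμν : μ ≠ ν) (a b : Fin (d + 1)) :
    StripRegular (d := d) (fun p => Gsym n μ ν a b p) κ (MG (d + 1)) := by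
  have hκ1 : κ ≤ 1 := (kappa_small hκ0 (hκ.trans (kappa166_le_rOf _))).1
  have he : Real.exp κ + 1 ≤ 4 := by
    have h1 : Real.exp κ ≤ Real.exp 1 := Real.exp_le_exp.mpr hκ1
    have h2 : Real.exp 1 < 3 := lt_trans Real.exp_one_lt_d9 (by norm_num)
    linarith
  have hW := stripRegular_W166 (d := d) n hκ0 hκ hμν
  have hc : StripRegular (d := d) (fun _ : Fin (d + 1) → ℂ => (1 / 2 : ℂ)) κ (1 / 2) := by
    have := stripRegular_const (d := d) (1 / 2 : ℂ) κ
    refine this.mono (le_of_eq ?_)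
    rw [norm_div, norm_one, Complex.norm_two]
  have hE := (stripRegular_expFacNeg (d := d) a κ).mul (stripRegular_expFacPos (d := d) b κ) (by positivity)
  have h := ((hc.mul hW (by norm_num)).mul hE (by have := MW_pos (d + 1); positivity))
  refine h.mono ?_
  unfold MG
  have hMW := MW_pos (d + 1)
  have h0 : 0 ≤ Real.exp κ + 1 := by positivity
  have : (Real.exp κ + 1) * (Real.exp κ + 1) ≤ 16 := by nlinarith
  calc 1 / 2 * MW (d + 1) * ((Real.exp κ + 1) * (Real.exp κ + 1)) ≤ 1 / 2 * MW (d + 1) * 16 := by gcongr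
    _ = 1 / 2 * MW (d + 1) * 16 := rfl

/-- ON REAL MOMENTA the entry symbol is the typed (1.66) weight times the form factors:
`Gsym(ι s) = ½ · w₁₆₆(s) · conj ∂¹_a(s) · ∂¹_b(s)` (`|s| ≤ π`, some `s_{ν₀} ≠ 0`, `μ ≠ ν`). [folklore] -/
theorem Gsym_ofReal (n : ℕ) [NeZero n] {μ ν : Fin d} (hμν : μ ≠ ν) (a b : Fin d) (s : Fin d → ℝ)
    (hs : ∀ κ, |s κ| ≤ Real.pi) (ν₀ : Fin d) (hν₀ : s ν₀ ≠ 0) :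
    Gsym n μ ν a b (ofRealVec s) = 1 / 2 * (w166 n μ ν s : ℂ) * ((starRingEnd ℂ) (d1Sym s a) * d1Sym s b) := by
  have hn : 1 ≤ n := Nat.one_le_iff_ne_zero.mpr (NeZero.ne n)
  unfold Gsym
  rw [W166_ofReal n hn hμν s hs ν₀ hν₀, expFacNeg_ofReal, expFacPos_ofReal]

/-- AT THE ORIGIN the entry symbol vanishes (the form factor `∂¹_b(0) = 0`). [folklore] -/
theorem Gsym_ofReal_zero (n : ℕ) [NeZero n] (μ ν a b : Fin d) :
    Gsym n μ ν a b (ofRealVec (fun _ => (0 : ℝ))) = 0 := by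
  unfold Gsym
  rw [expFacPos_ofReal]
  simp [d1Sym]

end Literature.MathematicalPhysics.QuantumFieldTheory.Balaban1983to89.B5Symbol166Strip
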